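import Mathlib
import Summits.ValiantsHypothesis.ValiantsHypothesis.Theorems.DivisionGapPerDivisionHardStubAtomicTop
import Summits.ValiantsHypothesis.ValiantsHypothesis.Theorems.NewtonUnitEquationsTwoProductsLevelCount

/-! # Rung `stub_projectionBound` — crux `TwoProducts` (stmt-ValiantsHypothesis-5906), line `corner-log-linearization`

THE PROJECTION BOUND (lead c7, Framework VII-E).  For every nonzero functional `ℓ ∈ ℕ²`, the south-west vertices of
`∏ u − ∏ v` number at most twice the number of `ℓ`-levels of its support, and those levels are values of `ℓ` on sums of one
monomial per factor: `V ≤ 2·(|{Σ_i ℓ(a_i) : a_i ∈ supp u_i}| + |{Σ_i ℓ(b_i) : b_i ∈ supp v_i}|)` — iterated one-dimensional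
sumsets of the projected supports.  (Letters in a box `[0,N]²` ⇒ `V ≤ 4(nN+1)`; projections in a common arithmetic progression of
length `K` ⇒ `V ≤ 4(nK+1)`: a super-polynomial vertex count needs letters exponentially spread in EVERY projection.)  The level count
itself (`≤ 2` south-west vertices per level of `ℓ`, for ANY polynomial) is the registered brick `stub_levelCount`. [folklore] -/

set_option linter.dupNamespace false -- single-conjunct summit: `ValiantsHypothesis.ValiantsHypothesis`

namespace Summit.ValiantsHypothesis.ValiantsHypothesis.Theorems.TwoProducts.ProjectionBound

open scoped BigOperators
open MvPolynomial

/-- Levels of a product: the value of a linear functional on a monomial of `∏ u_i` is its value on a sum of monomials of the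
factors. [folklore] -/
theorem level_mem_image_of_mem_support_prod {n : ℕ} (u : Fin n → MvPolynomial (Fin 2) ℂ) (ℓ : Fin 2 → ℕ)
    {e : Fin 2 →₀ ℕ} (he : e ∈ (∏ i, u i).support) :
    ℓ 0 * e 0 + ℓ 1 * e 1 ∈ (Fintype.piFinset fun i => (u i).support).image
      (fun a : Fin n → (Fin 2 →₀ ℕ) => ∑ i, (ℓ 0 * a i 0 + ℓ 1 * a i 1)) := by
  classical
  obtain ⟨g, hg, rfl⟩ :=
    DivisionGapPerDivisionHard.exists_eq_sum_of_mem_support_finset_prod Finset.univ u he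
  refine Finset.mem_image.mpr ⟨g, Fintype.mem_piFinset.mpr fun i => hg i (Finset.mem_univ _), ?_⟩
  simp only [Finsupp.coe_finsetSum, Finset.sum_apply, Finset.mul_sum, ← Finset.sum_add_distrib]

/-- **RUNG `stub_projectionBound`** (registered signature), from the landed level count `stub_levelCount` (p133723). [folklore] -/
theorem stub_projectionBound :
    ∀ (n : ℕ) (u v : Fin n → MvPolynomial (Fin 2) ℂ) (ℓ : Fin 2 → ℕ), ℓ ≠ 0 →
    {e : Fin 2 →₀ ℕ | ∃ w : Fin 2 → ℤ, 0 < w 0 ∧ 0 < w 1 ∧ e ∈ (∏ i, u i - ∏ i, v i).support ∧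
        ∀ e' ∈ (∏ i, u i - ∏ i, v i).support, e' ≠ e →
          w 0 * (e 0 : ℤ) + w 1 * (e 1 : ℤ) < w 0 * (e' 0 : ℤ) + w 1 * (e' 1 : ℤ)}.ncard
      ≤ 2 * (((Fintype.piFinset fun i => (u i).support).image
                (fun a : Fin n → (Fin 2 →₀ ℕ) => ∑ i, (ℓ 0 * a i 0 + ℓ 1 * a i 1))).card +
             ((Fintype.piFinset fun i => (v i).support).image
                (fun a : Fin n → (Fin 2 →₀ ℕ) => ∑ i, (ℓ 0 * a i 0 + ℓ 1 * a i 1))).card) := by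
  classical
  intro n u v ℓ hℓ
  refine le_trans (LevelCount.stub_levelCount (∏ i, u i - ∏ i, v i) ℓ hℓ) (Nat.mul_le_mul_left 2 ?_)
  refine le_trans (Finset.card_le_card ?_) (Finset.card_union_le _ _)
  intro m hm
  obtain ⟨q, hq, rfl⟩ := Finset.mem_image.mp hm
  rcases Finset.mem_union.mp (support_sub (σ := Fin 2) _ _ hq) with h | h
  · exact Finset.mem_union_left _ (level_mem_image_of_mem_support_prod u ℓ h)
  · exact Finset.mem_union_right _ (level_mem_image_of_mem_support_prod v ℓ h)

end Summit.ValiantsHypothesis.ValiantsHypothesis.Theorems.TwoProducts.ProjectionBound
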